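import Mathlib.Geometry.Manifold.Instances.Sphere
import Mathlib.Geometry.Manifold.Diffeomorph
import Mathlib.AlgebraicTopology.FundamentalGroupoid.SimplyConnected
import Literature.Topology.FourManifolds.WallStabilisation
import Literature.Topology.FourManifolds.HomotopyS4SimplyConnected
import HarnessLib

/-!
# Barrier (SmoothPoincare4): stable diffeomorphism invariants — in particular semisimple 4-dimensional TFTs — cannot detect a homotopy 4-sphere

Barrier catalogue `Literature/Barriers/SmoothPoincare4/` (D-0021), entry for the technique class
**"distinguish an exotic 4-sphere `Σ` from `S⁴` by an invariant of the `S² × S²`-stable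
diffeomorphism type"**, whose printed instance is Reutter's theorem that every semisimple
oriented 4-dimensional topological field theory is such an invariant.

## What is printed

* Wall 1964, Thm. 3 (tree: `Literature.Topology.FourManifolds.exists_isStabilization_of_isHCobordant`): h-cobordant simply
  connected closed smooth 4-manifolds `M`, `N` satisfy `M # k(S² × S²) ≅ N # k(S² × S²)` for some
  `k`; with Kervaire–Milnor 1963, Thm. 1.1 (`Θ₄ = 0`: every homotopy 4-sphere is h-cobordant to
  `S⁴`; tree: `Literature.Topology.FourManifolds.isHCobordant_sphere_of_homotopySphere_four`) every homotopy 4-sphere `Σ` has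
  `Σ # k(S² × S²) ≅ # k(S² × S²)` for some `k` (tree, proved:
  `Literature.Topology.FourManifolds.exists_isStabilization_sphere_of_homotopySphere_four`).
* Reutter 2023 (arXiv §1.1), Thm. 1: "Let `Z` be a semisimple oriented 4-dimensional topological
  field theory and let `W` and `W'` be `S² × S²`-stably diffeomorphic connected compact oriented
  4-bordisms. Then `Z(W) = Z(W')`." Cor. 2: for closed oriented `M`, `N`, "If there is an
  orientation-preserving homeomorphism `M → N`, then `Z(M) = Z(N)`" and "If `M` and `N` are
  simply connected and if there is an orientation-preserving homotopy equivalence `M → N`, then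
  `Z(M) = Z(N)`"; abstract: semisimple 4d TFTs "can therefore not distinguish homeomorphic closed
  oriented smooth 4-manifolds"; §1.1: "Every currently known example of a full 4-dimensional
  oriented topological field theory is semisimple ..., including invertible field theories ...,
  unitary field theories (Theorem 2.9), and once-extended field theories (Theorem 2.10)".
  Mechanism: Def. 2.6 (`Z` semisimple iff `Z(S³)` and `Z(S² × S¹)` are semisimple algebras);
  Prop. 3.2 (`Z(S³) ≅ k` ⇒ `Z(M # N) = Z(S⁴)⁻¹ Z(M) Z(N)`); Thm. 3.5 (`Z(S² × S²)` invertible for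
  indecomposable semisimple `Z`).
* Reutter–Schommer-Pries 2022, Thm. A / Thm. 1.1: in every even dimension semisimple TFTs give
  stable diffeomorphism invariants, and for closed 4-manifolds with finite `π₁` they detect
  exactly the stable diffeomorphism class.

## How it is rendered here (relative to the tree's named facts, D-0014)

* `IsStableInvariant I` — the technique class, explicit: functions `I` of connected closed smooth
  4-manifolds with `I M = I N` whenever some closed smooth `P` is a `k`-fold stabilisation
  (`Literature.SPC4.IsStabilization k`, i.e. `# k(S² × S²)` in the tree's relational form) of both.
* `StableBarrierFour.{u}` — the barrier: every `I` in the class (values in any `α : Type u`) has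
  `I Σ = I S⁴` on every homotopy 4-sphere `Σ` (`Literature.HomotopySphere 4`); PROVED
  (`stableBarrierFour_of_wall`) from Wall's Thm. 3, `Θ₄ = 0` and `π₁(S⁴) = 1` (tree facts,
  hypotheses).
* `isStableInvariant_of_connectedSum_prod` — PROVED: Reutter's mechanism in the abstract — a
  function multiplying by an injective `φ : α → α` under `# (S² × S²)` and invariant under
  diffeomorphism is in the class (abstracting `Z(M # S²×S²) = Z(S⁴)⁻¹ Z(S²×S²) · Z(M)` with the
  scalar invertible, Prop. 3.2 + Thm. 3.5). TFTs themselves (symmetric monoidal functors on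
  `Bord₄`) are not in Mathlib or the tree; Reutter's Thm. 1 enters as a citation only.
* `isStableInvariant_const`, `IsStableInvariant.postcomp`, `IsStableInvariant.prod` — PROVED
  closure properties of the class (audit 2026-08-16): constants are members, the image of a member
  under any function of its values is a member, a pair of members is a member (no combination of
  stable invariants, and nothing read off from one, detects `Σ`).
* `isStableInvariant_of_connectedSum_mul` — PROVED (audit 2026-08-16): the ring-valued form of
  Reutter's mechanism — a diffeomorphism invariant with `I (M # S²×S²) = z * I M` for a LEFT-REGULAR
  `z` (a non-zero-divisor; in a field: `z ≠ 0`) is a member; this is the exact contrapositive of the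
  printed escape condition "for a 4-dimensional TQFT to have the potential to detect exotic smooth
  structures, it must vanish on `S² × S²`" (Décoppet–Haïoun 2025, p. 2; Costantino–Geer–Haïoun–
  Patureau-Mirand 2026, Prop. 6.16), sharpened from "vanish" to "be a zero-divisor".
* `StableBarrierFour.nonempty_diffeomorph_sphere_of_isStableInvariant` — PROVED (audit
  2026-08-16): the indicator `M ↦ Nonempty (M ≃ₘ S⁴)` is a member only if every homotopy 4-sphere
  is diffeomorphic to `S⁴`; so the complement of the class contains `SmoothPoincare4`-complete
  functions and the zero-multiplier escape cannot be closed by enlarging the class short of the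
  conjecture itself.

## Audit record (barrier-audit 2026-08-16: CONFIRMED at page level; class ENLARGED in print; escape condition made precise)

Every citation of the entry was re-read in the materialised sources: Reutter (arXiv:2001.02288)
§1.1 p. 3 (Thm. 1 with its footnote — same `n` on both sides, sums in the interior —, Cor. 2, and
"Every currently known example of a full 4-dimensional oriented topological field theory is
semisimple"), §2 p. 6 ("Throughout, we let `k` be an algebraically closed field"), Def. 2.6,
Prop. 2.8, Thm. 2.9 (`k = ℂ`), Thm. 2.10 (target `2Vect_k` or any bicategory of the bestiary of
[III]), Prop. 3.2, Thm. 3.5 and the proof of Thm. 1 (§3.1); Reutter–Schommer-Pries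
(arXiv:2206.10031, Adv. Math. 482 (2025)) §1 Thms. A, B, 1.1 and "in dimensions `> 4`, (exotic)
spheres are diffeomorphic if and only if they are stably diffeomorphic"; Wall 1964 Thm. 3 (p. 141,
proof pp. 146–147); Kervaire–Milnor 1963 p. 504 (the TABLE `|Θ₄| = 1`; Thm. 1.1 itself is "the
h-cobordism classes of homotopy n-spheres form an abelian group"); Ren–Willis 2024 Prop. 2.4,
Ex. 3.2, Prop. 6.17. Nothing printed contradicts or evades the barrier STATEMENT, which is a
theorem relative to `Θ₄ = 0` (`StableInvariantsBlindThetaFour.lean`). Findings: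

1. **Class enlarged in print.** Reutter–Schommer-Pries define semisimplicity for
   `Z : Bord_d^B → sVect`, `d = 2q`, `B → BO(d)` any tangential `(q-1)`-type with `B` connected
   (Def. 5.13), and prove that such `Z` take equal values on `B`-stably diffeomorphic `B`-manifolds
   (Thm. 5.21); "a class of field theories which contains all currently known functorial
   topological field theories in more than two dimensions" (§1). For `d = 4` this adds SUPER
   (`ℤ/2`-graded) theories and every tangential 1-type (unoriented, spin, pin±, `B = K(π,1)`-twisted
   …) to the oriented `Vect_k`-valued theories of the entry; a homotopy 4-sphere carries each such
   structure that `S⁴` carries, uniquely up to the `π₀`-choice (`H¹(Σ; π₁F) = 0`), and the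
   diffeomorphism `Σ # k(S²×S²) ≅ # k(S²×S²)` of Wall–Kervaire–Milnor respects it (both sides simply
   connected), so all of these are blind on `Σ` [cite: ReutterSchommerPries2022, Def. 5.13 and Thm. 5.21].
   Conversely the class has no hidden interior: for finite `π₁`, closed 4-manifolds are stably
   diffeomorphic iff indistinguishable by semisimple TFTs iff indistinguishable by type-1
   generalised Dijkgraaf–Witten theories [cite: ReutterSchommerPries2022, Thm. 1.1].
2. **The escape condition, precisely.** For a TFT-type invariant that is MULTIPLICATIVE under `#`
   (Reutter Prop. 3.2; CGHP Prop. 6.14; skein lasagna modules, Ren–Willis Prop. 2.4 = Manolescu–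
   Neithalath Thm. 1.4) membership in the class follows as soon as the `S² × S²`-multiplier is
   left-regular (`isStableInvariant_of_connectedSum_mul`); the printed contrapositive is "it must
   vanish on `S² × S²` and at least one of `ℂℙ²` and `ℂℙ²bar`" [cite: DecoppetHaioun2025, §Introduction p. 2]
   [cite: CostantinoEtAl2026, Prop. 6.16]. Carriers of an `S² × S²`-ANNIHILATED multiplicative
   invariant now exist in print, none of them a functorial TFT on `Bord₄` with a closed-manifold
   value separating anything: (α) Khovanov skein lasagna modules `𝒮₀²` VANISH on `S² × S²`, `ℂℙ²`
   and `K3bar` (every 4-manifold containing a sphere of positive square) [cite: RenWillis2024, Example 3.2 (from Thm. 1.4)],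
   are `⊗`-multiplicative under `#` [cite: RenWillis2024, Prop. 2.4] and detect exotic COMPACT pairs
   with boundary [cite: RenWillis2024, Thm. 1.1]; on homotopy 4-spheres they are constrained only by
   `ℂℙ²bar`-dissolution over `ℚ` [cite: RenWillis2024, Prop. 6.17] and by Gluck-twist invariance
   over `ℚ` [cite: RenEtAl2025, Thm. 1.5 = Thm. 7.1 and Cor. 7.2] (entries A7, C1 of the
   catalogue); (β) Décoppet–Haïoun's characteristic-`p` Temperley–Lieb skein invariant
   `Ṡ^{ζ^{1/2}}_{p(2)}`, `p > 3`, vanishes on `ℂℙ²`, `ℂℙ²bar` AND `S² × S²` ("not subject to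
   stabilization") [cite: DecoppetHaioun2025, Thm. B] but admits NO 1-handle map
   [cite: DecoppetHaioun2025, Thm. A]: it is an invariant of 4-dimensional 2-handlebodies up to
   2-equivalence, not known to be a diffeomorphism invariant [cite: DecoppetHaioun2025, Question E]
   (tree: `Literature/QuantumTopology/MixedVerlinde/`, route `VerlindeRLinks`); (γ) the
   NON-COMPACT `(3+1)`-TQFTs of Costantino–Geer–Haïoun–Patureau-Mirand [cite: CostantinoEtAl2026, Thm. 6.6]
   give a multiplicative scalar `Ṡ_C` of closed connected 4-manifolds for every chromatic
   non-degenerate `C` [cite: CostantinoEtAl2026, Prop. 6.14], with `Z(S² × S¹)` NON-semisimple in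
   an explicit characteristic-`p` example ("so it does not fall under Reutter's theorem")
   [cite: CostantinoEtAl2026, Prop. 7.7 and Prop. 7.8] — so Reutter's HYPOTHESIS can fail for
   theories of this kind, while membership in the formal class is decided by the value on
   `S² × S²` alone —, yet every example whose value on `S² × S²` has been computed has
   `Ṡ_C(S² × S²) ≠ 0` [cite: CostantinoEtAl2026, Prop. 7.5 and §1 p. 7] and is therefore a MEMBER
   by `isStableInvariant_of_connectedSum_mul` (likewise the small-quantum-group, Beliakova–De Renzi,
   Faes–Manko and Manko examples: "in all of these examples, the corresponding invariants do not
   vanish on `S² × S²`" [cite: DecoppetHaioun2025, §Introduction pp. 3 and 5]). "Every currently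
   known example … is semisimple" (2020) should now be read as: every closed-4-manifold TFT-type
   invariant in print that is a diffeomorphism invariant with a computed value on `S² × S²` has a
   regular `S² × S²`-multiplier; the one printed `S² × S²`-annihilated skein invariant,
   `Ṡ^{ζ^{1/2}}_{p(2)}`, is not known to be a diffeomorphism invariant (Décoppet–Haïoun's open
   Question E).
3. **Sharpness.** The boundary of the class is `SmoothPoincare4`-hard
   (`StableBarrierFour.nonempty_diffeomorph_sphere_of_isStableInvariant`): no theorem of the form
   "every multiplicative diffeomorphism invariant is blind on homotopy 4-spheres" can hold unless the
   conjecture does, so finding 2 is the whole escape and cannot be legislated away.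
4. **Relative values (not claimed, recorded for planners).** Reutter's Thm. 1 equates `Z(W)`,
   `Z(W')` for bordisms `S² × S²`-stably diffeomorphic REL BOUNDARY (Def. 3.1); `Σ ∖ B̊⁴` is stably
   diffeomorphic to `B⁴` rel `S³`, so `Z(Σ ∖ B̊⁴) = Z(B⁴)` for semisimple `Z` (Prop. 3.2 with
   `Z(Σ) = Z(S⁴)`), but complements in `Σ` of surfaces or 2-complexes are not known to be stably
   diffeomorphic rel `∂` to pieces of `S⁴`; such relative values, like all defect / lasagna /
   2-handlebody uses, are outside `IsStableInvariant` by definition and are not blocked here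
   [cite: Reutter2023SemisimpleTFT, §3 Def. 3.1 and Prop. 3.2].

## References

[WallJLMS1964] [KervaireMilnorAnnals1963] [Reutter2023SemisimpleTFT]
[ReutterSchommerPries2022] [FreedmanGompfMorrisonWalker2010] [HatcherAT2002]
[RenWillis2024] [RenEtAl2025] [CostantinoEtAl2026] [DecoppetHaioun2025] [ManolescuNeithalath2022]
-/

noncomputable section

open scoped Manifold ContDiff
open ContinuousMap Function

namespace Literature.Barriers.SmoothPoincare4

universe u

/-- Local notation: `𝔼 n` is the model Euclidean space `EuclideanSpace ℝ (Fin n)`. -/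
local notation "𝔼 " n:arg => EuclideanSpace ℝ (Fin n)

/-- Local notation: `𝕊 n` is the unit sphere in `EuclideanSpace ℝ (Fin (n + 1))`, the standard
`n`-sphere with its Mathlib manifold structure. -/
local notation "𝕊 " n:arg => (Metric.sphere (0 : EuclideanSpace ℝ (Fin (n + 1))) 1)

open Literature.Topology.FourManifolds

/-! ### The technique class -/

/-- **Technique class: invariants of the `S² × S²`-stable diffeomorphism type.** `I` assigns a
value in `α` to every 4-dimensional charted space (only CONNECTED closed smooth 4-manifolds —
Hausdorff, second countable, compact, connected, `C^∞` on `ℝ⁴`, in `Type` — matter), and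
`I M = I N` whenever `M`, `N` are connected closed smooth and some closed smooth `P` is a `k`-fold
stabilisation of both (`Literature.SPC4.IsStabilization k M P ∧ Literature.SPC4.IsStabilization k N P`, the
tree's relational form of `M # k(S² × S²) ≅ P ≅ N # k(S² × S²)`, Wall 1964 §1; the same `k` on
both sides, as in Reutter's footnote to Thm. 1). Connectedness of `M`, `N` is imposed because the
tree's `IsConnectedSum` records no connectedness, so for disconnected manifolds the `k` summands
may land in different components, a relation under which the printed members are NOT invariant;
Reutter's Thm. 1 is printed for "connected compact oriented 4-bordisms" and says that (the
closed-connected-manifold part of) every semisimple oriented 4-dimensional TFT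
`Z : Bord₄ → Vect_k` is such an `I` (for orientable `M`, through its values on both
orientations). [cite: Reutter2023SemisimpleTFT, §1.1 Thm. 1 with footnote] [cite: WallJLMS1964, §1 and Thm. 3] -/
def IsStableInvariant {α : Type*}
    (I : ∀ (M : Type) [TopologicalSpace M] [ChartedSpace (𝔼 4) M], α) : Prop :=
  ∀ (k : ℕ) (M N P : Type)
    [TopologicalSpace M] [T2Space M] [SecondCountableTopology M] [ChartedSpace (𝔼 4) M]
    [IsManifold (𝓡 4) ∞ M] [CompactSpace M] [ConnectedSpace M]
    [TopologicalSpace N] [T2Space N] [SecondCountableTopology N] [ChartedSpace (𝔼 4) N]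
    [IsManifold (𝓡 4) ∞ N] [CompactSpace N] [ConnectedSpace N]
    [TopologicalSpace P] [T2Space P] [SecondCountableTopology P] [ChartedSpace (𝔼 4) P]
    [IsManifold (𝓡 4) ∞ P] [CompactSpace P],
    IsStabilization k M P → IsStabilization k N P → I M = I N

/-! ### The barrier -/

/-- **Barrier (named statement): no invariant of the stable diffeomorphism type distinguishes a
homotopy 4-sphere from `S⁴`.** For every `α`, every `I` with `IsStableInvariant I` and every
homotopy 4-sphere `Σ` (`Literature.HomotopySphere 4`: closed smooth oriented, `≃ₕ S⁴`), `I Σ = I S⁴`;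
the value universe `u` of `α` is a parameter (`StableBarrierFour.{u}`), so that invariants valued in
large types (modules, categories of them) are covered. PROVED below (`stableBarrierFour_of_wall`)
from Wall's Thm. 3 and `Θ₄ = 0` as vendored in the tree; relative to Literature the barrier is a
theorem.

BARRIER (D-0021), one line per key:
* technique_class: invariants of connected closed smooth 4-manifolds constant on `S² × S²`-stable diffeomorphism classes (`IsStableInvariant`); printed members: every semisimple oriented 4-dimensional TFT `Z : Bord₄ → Vect_k` (`k` algebraically closed) on connected closed manifolds [cite: Reutter2023SemisimpleTFT, §1.1 Thm. 1], which includes all invertible, all unitary (Thm. 2.9) and all once-extended (Thm. 2.10) oriented 4d TFTs — "Every currently known example of a full 4-dimensional oriented topological field theory is semisimple" [cite: Reutter2023SemisimpleTFT, §1.1]; more generally semisimple TFTs in any even dimension [cite: ReutterSchommerPries2022, Thm. A], valued in super vector spaces and with any tangential 1-type `B → BO(4)` (`B` connected: oriented, unoriented, spin, pin±, `K(π,1)`-twisted …), which are `B`-stable diffeomorphism invariants [cite: ReutterSchommerPries2022, Def. 5.13 and Thm. 5.21 (arXiv numbering)] — a homotopy 4-sphere carries each such structure that `S⁴` does, uniquely,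 and Wall's diffeomorphism respects it (audit 2026-08-16); abstractly, any diffeomorphism invariant that multiplies by an injective map under `# (S² × S²)` (`isStableInvariant_of_connectedSum_prod`), in particular any ring-valued invariant with `I (M # S²×S²) = z * I M` for a left-regular (non-zero-divisor) `z` (`isStableInvariant_of_connectedSum_mul`) — e.g. the multiplicative closed-manifold scalar `Ṡ_C` of every NON-COMPACT `(3+1)`-TQFT of Costantino–Geer–Haïoun–Patureau-Mirand with `Ṡ_C(S² × S²) ≠ 0`, semisimple or not [cite: CostantinoEtAl2026, Prop. 6.14 and Prop. 6.16]; the class is closed under post-composition and pairing (`IsStableInvariant.postcomp`, `IsStableInvariant.prod`).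
* blocks: refuting `SmoothPoincare4` (`Literature.SPC4.SmoothPoincareConjectureFour`; bundled form `∀ S : HomotopySphere 4, S ≅ S⁴`) by exhibiting such an invariant with `I Σ ≠ I S⁴` (`StableBarrierFour`), e.g. "the construction of a 4-dimensional topological field theory in the sense of Atiyah-Segal which is sensitive to exotic smooth structure ... no semisimple topological field theory can achieve this goal" [cite: Reutter2023SemisimpleTFT, §1.1].
* because: every homotopy 4-sphere is h-cobordant to `S⁴` [cite: KervaireMilnorAnnals1963, Thm. 1.1] and h-cobordant simply connected closed smooth 4-manifolds are `S² × S²`-stably diffeomorphic [cite: WallJLMS1964, Thm. 3], so `Σ # k(S² × S²) ≅ # k(S² × S²)` (tree `Literature.Topology.FourManifolds.exists_isStabilization_sphere_of_homotopySphere_four`) and a stable invariant takes equal values (`stableBarrierFour_of_wall`); a semisimple `Z` is a finite sum of indecomposable theories, each multiplicative under `#` with `Z(M # N) = Z(S⁴)⁻¹ Z(M) Z(N)` [cite: Reutter2023SemisimpleTFT, Prop. 3.2] and with `Z(S² × S²)` invertible [cite: Reutter2023SemisimpleTFT, Thm. 3.5], hence `S² × S²`-stable [cite: Reutter2023SemisimpleTFT,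 §3.1 and Thm. 1].
* evasions_known: inside the class there is nothing to find — for finite `π₁` semisimple TFTs (indeed type-1 generalised Dijkgraaf–Witten theories) see EXACTLY the stable diffeomorphism class [cite: ReutterSchommerPries2022, Thm. 1.1]; the only way out for an invariant multiplicative under `#` is an `S² × S²`-multiplier that is a ZERO-DIVISOR ("it must vanish on `S² × S²` and at least one of `ℂℙ²` and `ℂℙ²bar`" [cite: DecoppetHaioun2025, §Introduction p. 2]; [cite: CostantinoEtAl2026, Prop. 6.16]), and as of the audit (2026-08-16) the printed carriers of such an `S² × S²`-ANNIHILATED invariant are: (i) Khovanov skein lasagna modules — vanishing on `S² × S²`, `ℂℙ²`, `K3bar` [cite: RenWillis2024, Example 3.2 (from Thm. 1.4)], `⊗`-multiplicative under `#` [cite: RenWillis2024, Prop. 2.4], detecting exotic compact pairs with boundary [cite: RenWillis2024, Thm. 1.1], not Atiyah–Segal TFTs, and on homotopy 4-spheres blind over `ℚ` on `ℂℙ²bar`-dissolving ones [cite: RenWillis2024, Prop. 6.17] and under Gluck twists [cite: RenEtAl2025, Thm. 1.5 = Thm. 7.1 and Cor. 7.2] (entries A7, C1); (ii) Décoppet–Haïoun's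 characteristic-`p` Temperley–Lieb skein invariant `Ṡ^{ζ^{1/2}}_{p(2)}` (`p > 3`), vanishing on `ℂℙ²`, `ℂℙ²bar`, `S² × S²` [cite: DecoppetHaioun2025, Thm. B] but with NO 1-handle map [cite: DecoppetHaioun2025, Thm. A] — an invariant of 4-dimensional 2-handlebodies up to 2-equivalence whose diffeomorphism invariance is open [cite: DecoppetHaioun2025, Question E] (route `VerlindeRLinks`); (iii) non-compact `(3+1)`-TQFTs from chromatic non-degenerate categories [cite: CostantinoEtAl2026, Thm. 6.6], which may have NON-semisimple `Z(S² × S¹)` [cite: CostantinoEtAl2026, Prop. 7.7 and Prop. 7.8] but every example whose value on `S² × S²` is computed has `Ṡ_C(S² × S²) ≠ 0` and is therefore a member [cite: CostantinoEtAl2026, Prop. 7.5 and §1 p. 7] [cite: DecoppetHaioun2025, §Introduction pp. 3 and 5]. No diffeomorphism invariant of CLOSED 4-manifolds that is `S² × S²`-annihilated and separates two closed manifolds is in print.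
* scope_caveats: (a) Reutter's theorem is about ORIENTED theories valued in `Vect_k`, `k` an algebraically closed field (any characteristic), semisimple in the sense of Def. 2.6 [cite: Reutter2023SemisimpleTFT, Def. 2.6 and Thm. 1]; Reutter–Schommer-Pries extend it to `sVect`-valued theories with any tangential 1-type [cite: ReutterSchommerPries2022, Thm. 5.21 (arXiv numbering)]; NOT covered: theories with non-semisimple `Z(S³)` or `Z(S² × S¹)` (which exist as non-compact TQFTs [cite: CostantinoEtAl2026, Prop. 7.8]) unless their `S² × S²`-multiplier is regular, derived/∞-categorical or partially defined (`(4,k)`-dualizable, `k < 4`) theories, theories with defects (lasagna), and RELATIVE values of a semisimple `Z` on pieces of `Σ` other than bordisms stably diffeomorphic rel `∂` to pieces of `S⁴` (Thm. 1 is rel `∂` [cite: Reutter2023SemisimpleTFT, §3 Def. 3.1]; `Z(Σ ∖ B̊⁴) = Z(B⁴)` does follow, values on surface / 2-complex complements do not); (b) the formal class `IsStableInvariant` is stated for functions of UNORIENTED, CONNECTED closed smooth 4-manifolds in `Type` (the tree's `IsStabilization`/`IsConnectedSum` carry neither orientation nor connectedness; connectedness of `M`, `N` is imposed explicitly, and for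 simply connected `M` the stabilisation is orientation-independent since `S² × S²` has an orientation-reversing diffeomorphism [cite: WallJLMS1964, §1]); (c) the barrier concerns closed homotopy 4-spheres only — for exotic smooth structures on manifolds with `b₂ > 0` or with boundary, stable invariants are equally blind whenever the structures are stably diffeomorphic (all homeomorphic closed oriented pairs, by Gompf 1984 as used in [cite: Reutter2023SemisimpleTFT, §1.1 Cor. 2]), which is not formalised here; (d) in dimensions `> 4` the analogous barrier is void: "in dimensions `> 4`, (exotic) spheres are diffeomorphic if and only if they are stably diffeomorphic" [cite: ReutterSchommerPries2022, §1.1] (dimensions `≤ 3` are void for a different reason: there are no exotic spheres).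
* status: established (theorem `stableBarrierFour_of_wall` relative to the tree facts `Literature.Topology.FourManifolds.exists_isStabilization_of_isHCobordant`, `Literature.Topology.FourManifolds.isHCobordant_sphere_of_homotopySphere_four`, `Literature.Topology.FourManifolds.simplyConnectedSpace_sphere_four`; since `StableInvariantsBlindThetaFour.lean` relative to `Θ₄ = 0` alone; membership of semisimple TFTs is [cite: Reutter2023SemisimpleTFT, Thm. 1]); audited 2026-08-16 (barrier-audit): every citation confirmed at page level (`Θ₄ = 0` is the table `|Θ₄| = 1` of [cite: KervaireMilnorAnnals1963, §1 p. 504], Thm. 1.1 being the group structure), class enlarged in print by [cite: ReutterSchommerPries2022, Thm. 5.21 (arXiv numbering)], escape condition sharpened to "zero-divisor on `S² × S²`" with its printed carriers listed under `evasions_known` [cite: WallJLMS1964, Thm. 3] [cite: KervaireMilnorAnnals1963, Thm. 1.1]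

[cite: Reutter2023SemisimpleTFT, §1.1 Thm. 1 and Cor. 2] [cite: WallJLMS1964, Thm. 3] -/
def StableBarrierFour : Prop :=
  ∀ (α : Type u) (I : ∀ (M : Type) [TopologicalSpace M] [ChartedSpace (𝔼 4) M], α),
    IsStableInvariant I → ∀ S : HomotopySphere 4, I S.carrier = I (𝕊 4)

/-- **The mechanism, for one invariant.** A stable invariant takes the value `I S⁴` on every
homotopy 4-sphere, GIVEN Wall's stabilisation theorem (`Literature.Topology.FourManifolds.exists_isStabilization_of_isHCobordant`,
Wall 1964 Thm. 3), `Θ₄ = 0` (`Literature.Topology.FourManifolds.isHCobordant_sphere_of_homotopySphere_four`, Kervaire–Milnor 1963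
Thm. 1.1) and `π₁(S⁴) = 1` (`Literature.Topology.FourManifolds.simplyConnectedSpace_sphere_four`): by the tree's corollary
`Literature.Topology.FourManifolds.exists_isStabilization_sphere_of_homotopySphere_four` some closed smooth `P` is a `k`-fold
stabilisation of both `Σ` and `S⁴`. [cite: WallJLMS1964, Thm. 3] [cite: KervaireMilnorAnnals1963, Thm. 1.1] -/
theorem IsStableInvariant.apply_homotopySphere_eq {α : Type*}
    {I : ∀ (M : Type) [TopologicalSpace M] [ChartedSpace (𝔼 4) M], α} (hI : IsStableInvariant I)
    (hW : exists_isStabilization_of_isHCobordant) (hΘ : isHCobordant_sphere_of_homotopySphere_four)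
    (hS4 : simplyConnectedSpace_sphere_four) (S : HomotopySphere 4) :
    I S.carrier = I (𝕊 4) := by
  obtain ⟨k, P, _, _, _, _, _, _, hSP, h4P⟩ :=
    exists_isStabilization_sphere_of_homotopySphere_four hW hΘ hS4 S
  obtain ⟨e⟩ := S.nonempty_homotopyEquiv
  haveI : SimplyConnectedSpace (𝕊 4) := hS4
  haveI : SimplyConnectedSpace S.carrier := e.simplyConnectedSpace
  exact hI k S.carrier (𝕊 4) P hSP h4P

/-- **`StableBarrierFour` holds**, GIVEN Wall's Thm. 3, `Θ₄ = 0` and `π₁(S⁴) = 1` (D-0014: named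
facts enter as hypotheses). [cite: WallJLMS1964, Thm. 3] [cite: Reutter2023SemisimpleTFT, §1.1 Cor. 2] -/
theorem stableBarrierFour_of_wall (hW : exists_isStabilization_of_isHCobordant)
    (hΘ : isHCobordant_sphere_of_homotopySphere_four) (hS4 : simplyConnectedSpace_sphere_four) :
    StableBarrierFour.{u} :=
  fun _ _ hI S => hI.apply_homotopySphere_eq hW hΘ hS4 S

/-! ### Reutter's mechanism in the abstract: multiplicative under `# (S² × S²)` ⇒ stable -/

section Multiplicative

variable {α : Type*} {I : ∀ (M : Type) [TopologicalSpace M] [ChartedSpace (𝔼 4) M], α}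
  {φ : α → α}

/-- Along a `k`-fold stabilisation, a function which is invariant under diffeomorphism and is
multiplied by `φ` under one connected sum with `S² × S²` changes by `φ^[k]`. The two hypotheses
are required for all 4-dimensional charted spaces occurring as intermediate stages of
`Literature.Topology.FourManifolds.IsStabilization` (Hausdorff smooth `M'`, which are closed as soon as the final `P` is,
though this is not used). Abstracts `Z(M # S²×S²) = Z(S⁴)⁻¹ Z(S²×S²) · Z(M)` for an indecomposable
semisimple TFT `Z`. [cite: Reutter2023SemisimpleTFT, Prop. 3.2 and proof of Thm. 1 (§3.1)] -/
theorem apply_eq_iterate_of_isStabilization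
    (hdiff : ∀ (M P : Type) [TopologicalSpace M] [ChartedSpace (𝔼 4) M]
      [TopologicalSpace P] [ChartedSpace (𝔼 4) P], Nonempty (M ≃ₘ⟮𝓡 4, 𝓡 4⟯ P) → I P = I M)
    (hmul : ∀ (M P : Type) [TopologicalSpace M] [T2Space M] [ChartedSpace (𝔼 4) M]
      [IsManifold (𝓡 4) ∞ M] [TopologicalSpace P] [ChartedSpace (𝔼 4) P],
      IsConnectedSum (𝓡 4) (𝓡 4) ((𝓡 2).prod (𝓡 2)) M ((𝕊 2) × (𝕊 2)) P → I P = φ (I M)) :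
    ∀ (k : ℕ) (M P : Type) [TopologicalSpace M] [ChartedSpace (𝔼 4) M]
      [TopologicalSpace P] [ChartedSpace (𝔼 4) P], IsStabilization k M P → I P = φ^[k] (I M)
  | 0, M, P, _, _, _, _, h => by simpa using hdiff M P h
  | k + 1, M, P, _, _, _, _, h => by
    obtain ⟨M', _, _, _, _, hk, hcs⟩ := h
    rw [hmul M' P hcs, apply_eq_iterate_of_isStabilization hdiff hmul k M M' hk,
      ← iterate_succ_apply' φ k]

/-- **Multiplicative under `# (S² × S²)` by an injective map ⇒ stable invariant** (so such
functions are subject to `StableBarrierFour`). This is the abstract form of Reutter's deduction of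
`S² × S²`-stability (Thm. 1) from multiplicativity (Prop. 3.2) and invertibility of `Z(S² × S²)`
(Thm. 3.5): multiplication by the invertible scalar `Z(S⁴)⁻¹ Z(S² × S²)` is injective.
[cite: Reutter2023SemisimpleTFT, §3.1, Prop. 3.2, Thm. 3.5, Thm. 1] -/
theorem isStableInvariant_of_connectedSum_prod (hφ : Injective φ)
    (hdiff : ∀ (M P : Type) [TopologicalSpace M] [ChartedSpace (𝔼 4) M]
      [TopologicalSpace P] [ChartedSpace (𝔼 4) P], Nonempty (M ≃ₘ⟮𝓡 4, 𝓡 4⟯ P) → I P = I M)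
    (hmul : ∀ (M P : Type) [TopologicalSpace M] [T2Space M] [ChartedSpace (𝔼 4) M]
      [IsManifold (𝓡 4) ∞ M] [TopologicalSpace P] [ChartedSpace (𝔼 4) P],
      IsConnectedSum (𝓡 4) (𝓡 4) ((𝓡 2).prod (𝓡 2)) M ((𝕊 2) × (𝕊 2)) P → I P = φ (I M)) :
    IsStableInvariant I := by
  intro k M N P _ _ _ _ _ _ _ _ _ _ _ _ _ _ _ _ _ _ _ _ hM hN
  apply hφ.iterate k
  rw [← apply_eq_iterate_of_isStabilization hdiff hmul k M P hM,
    ← apply_eq_iterate_of_isStabilization hdiff hmul k N P hN]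

end Multiplicative

/-! ### Closure, the ring-level criterion and sharpness of the class (audit 2026-08-16) -/

section Closure

variable {α β : Type*} {I : ∀ (M : Type) [TopologicalSpace M] [ChartedSpace (𝔼 4) M], α}
  {J : ∀ (M : Type) [TopologicalSpace M] [ChartedSpace (𝔼 4) M], β}

/-- **Constant functions are stable invariants** (the class is inhabited at every value type; a
sanity check that the relation, not the conclusion, carries the barrier). [folklore] -/
theorem isStableInvariant_const (a : α) :
    IsStableInvariant (fun (M : Type) [TopologicalSpace M] [ChartedSpace (𝔼 4) M] => a) :=
  fun _ _ _ _ _ _ _ _ _ _ _ _ _ _ _ _ _ _ _ _ _ _ _ _ _ _ => rfl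

/-- **The class is closed under post-composition**: anything read off from a stable invariant
(e.g. the dimension of a state space, a coefficient of a partition function, the image under a
comparison homomorphism) is a stable invariant, hence blind on homotopy 4-spheres by
`StableBarrierFour`. [folklore] -/
theorem IsStableInvariant.postcomp (hI : IsStableInvariant I) (f : α → β) :
    IsStableInvariant (fun (M : Type) [TopologicalSpace M] [ChartedSpace (𝔼 4) M] => f (I M)) :=
  fun k M N P _ _ _ _ _ _ _ _ _ _ _ _ _ _ _ _ _ _ _ _ hM hN => congrArg f (hI k M N P hM hN)

/-- **The class is closed under pairing**: no COMBINATION of stable invariants (e.g. the family of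
all semisimple TFT partition functions at once, which for finite `π₁` recovers exactly the stable
diffeomorphism class) detects a homotopy 4-sphere. [cite: ReutterSchommerPries2022, Thm. 1.1] -/
theorem IsStableInvariant.prod (hI : IsStableInvariant I) (hJ : IsStableInvariant J) :
    IsStableInvariant (fun (M : Type) [TopologicalSpace M] [ChartedSpace (𝔼 4) M] => (I M, J M)) :=
  fun k M N P _ _ _ _ _ _ _ _ _ _ _ _ _ _ _ _ _ _ _ _ hM hN =>
    Prod.ext (hI k M N P hM hN) (hJ k M N P hM hN)

end Closure

section Ring

variable {R : Type*} [Mul R] {I : ∀ (M : Type) [TopologicalSpace M] [ChartedSpace (𝔼 4) M], R}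
  {z : R}

/-- **Ring-level criterion: a multiplicative invariant with a LEFT-REGULAR `S² × S²`-multiplier is
a stable invariant.** If `I` is a diffeomorphism invariant of 4-dimensional charted spaces valued
in any `R` with a multiplication, and one connected sum with `S² × S²` multiplies the value by a
fixed `z` with `z * ·` injective (`IsLeftRegular z`: a non-zero-divisor in a ring, a non-zero
scalar in a field), then `I` is constant on `S² × S²`-stable diffeomorphism classes and is subject
to `StableBarrierFour`. This is Reutter's Prop. 3.2 + Thm. 3.5 ⇒ Thm. 1 in the abstract
(`z = Z(S⁴)⁻¹ Z(S² × S²)`), and equally the closed-manifold scalar `Ṡ_C` of a non-compact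
`(3+1)`-TQFT, multiplicative by CGHP Prop. 6.14, whenever `Ṡ_C(S² × S²) ≠ 0` (CGHP Prop. 6.16);
contrapositively it is the printed necessary condition for detecting exotic smooth structure —
"it must vanish on `S² × S²`" (Décoppet–Haïoun, Introduction) — sharpened from "vanish" to "be a
zero-divisor" for ring-valued theories.
[cite: Reutter2023SemisimpleTFT, Prop. 3.2, Thm. 3.5 and Thm. 1] [cite: CostantinoEtAl2026, Prop. 6.14 and Prop. 6.16] [cite: DecoppetHaioun2025, §Introduction p. 2] -/
theorem isStableInvariant_of_connectedSum_mul (hz : IsLeftRegular z)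
    (hdiff : ∀ (M P : Type) [TopologicalSpace M] [ChartedSpace (𝔼 4) M]
      [TopologicalSpace P] [ChartedSpace (𝔼 4) P], Nonempty (M ≃ₘ⟮𝓡 4, 𝓡 4⟯ P) → I P = I M)
    (hmul : ∀ (M P : Type) [TopologicalSpace M] [T2Space M] [ChartedSpace (𝔼 4) M]
      [IsManifold (𝓡 4) ∞ M] [TopologicalSpace P] [ChartedSpace (𝔼 4) P],
      IsConnectedSum (𝓡 4) (𝓡 4) ((𝓡 2).prod (𝓡 2)) M ((𝕊 2) × (𝕊 2)) P → I P = z * I M) :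
    IsStableInvariant I :=
  isStableInvariant_of_connectedSum_prod (φ := fun x => z * x) hz hdiff hmul

end Ring

/-- **Sharpness: the boundary of the class is `SmoothPoincare4`-hard.** GIVEN the barrier (a
theorem relative to `Θ₄ = 0`, `StableInvariantsBlindThetaFour.lean`), the indicator
`M ↦ Nonempty (M ≃ₘ S⁴)` — a diffeomorphism invariant, trivially "multiplicative" under
`# (S² × S²)` with the ZERO multiplier once connected sums with `S² × S²` are known not to be
`S⁴` — is a stable invariant only if every homotopy 4-sphere is diffeomorphic to `S⁴` (the bundled
form of `SmoothPoincare4`). So the complement of `IsStableInvariant` contains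
`SmoothPoincare4`-complete functions: no enlargement of the technique class to "all multiplicative
diffeomorphism invariants" (dropping the regularity of the `S² × S²`-multiplier, which is exactly
the escape of `S² × S²`-annihilated skein invariants, Décoppet–Haïoun Thm. B, Ren–Willis Ex. 3.2)
can be a theorem short of the conjecture. [cite: DecoppetHaioun2025, Thm. B and Question E] [cite: RenWillis2024, Example 3.2] -/
theorem StableBarrierFour.nonempty_diffeomorph_sphere_of_isStableInvariant
    (h : StableBarrierFour.{0})
    (hI : IsStableInvariant (fun (M : Type) [TopologicalSpace M] [ChartedSpace (𝔼 4) M] =>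
      Nonempty (M ≃ₘ⟮𝓡 4, 𝓡 4⟯ (𝕊 4))))
    (S : HomotopySphere 4) : Nonempty (S.carrier ≃ₘ⟮𝓡 4, 𝓡 4⟯ (𝕊 4)) := by
  rw [h Prop _ hI S]
  exact ⟨Diffeomorph.refl _ _ _⟩

end Literature.Barriers.SmoothPoincare4

end
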